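import Literature.Computability.AlgebraicComplexity.CNFPermanentTwoSite
import Literature.LinearAlgebra.Matrix.PermanentZeroOneLift
import Literature.Computability.AlgebraicComplexity.PermanentBitsPPoly
import HarnessLib

/-!
# Valiant's reduction `#3SAT → PERMANENT(0/1)` on one formula: the `0/1` matrix of a 3CNF as an explicit word

Continuation of `AlgebraicComplexity/CNFPermanentTwoSite.lean` (`per (twoSiteMatrix φ) = 2^{6m} ·
#SAT(φ)`, entries in `{-1, 0, 1}`, on the structured index type
`BaseIdx φ ⊕ Fin 6m × Fin 4`) and `LinearAlgebra/Matrix/PermanentZeroOneLift.lean` (the `0/1` lift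
modulo `2^q + 1`). This file lays both out on `Fin n` with EXPLICIT arithmetic numberings and
re-expresses every entry as a closed-form function of natural-number indices — the form in which
the polynomial-time machine of `PermanentHardness`'s discharge writes the matrix down — and derives
Valiant's theorem (TCS 8 (1979), Thm. 1) for one formula as an identity of numbers:

* layouts `eBase`, `eG`, `eTot` (`finSumFinEquiv`/`finProdFinEquiv`: clause node `r ↦ r`,
  equality block `p` slot `g ↦ 7m + 4p + g`, core of variable `k` index `g ↦ 19m + 4k + g`, gadget
  slot `s` node `j ↦ 43m + s(q+1) + j`), `gMatrix φ` (`43m × 43m`, entries `{-1,0,1}`,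
  `permanent_gMatrix : per = 2^{6m} #SAT`), `bMatrix φ` (`n × n`, `n = 43m + (43m)²(9m+1)`, `0/1`);
* **`ℕ`-indexed closed forms** `baseEntry`, `site1`, `site2`, `portEntry`, `gEntry`, `actOf`,
  `bEntry` with `gMatrix_apply : gMatrix φ x y = gEntry φ x y` and
  `bMatrix_apply : bMatrix φ x y = [bEntry φ x y]` (through `hConst`, `sPos`, `nextPos` of the
  two-site file, `e3c`/`coreC` the two `4 × 4` tables, `liftAct`, `slotMatrix_apply`);
* the row-major word `bWord φ` of `bMatrix φ` and `per01PlainFn_bWord :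
  per01PlainFn (bWord φ) = per (bMatrix φ)` (`PermanentBitsPPoly.per01PlainFn`, the plain
  transcription of the `0/1` permanent function; `permanent_of_bool`);
* **`numSat_eq_per01PlainFn`**: for a 3CNF `φ` with `m` clauses,
  `#SAT(φ) = (per01PlainFn (bWord φ) % (2^{9m} + 1)) / 2^{6m}`
  (`toNat_permanent_zeroOneLift_mod` with `0 ≤ per ≤ 2^{9m}`).

What remains for `IsSharpPHardFun per01PlainFn` (equivalently `permanent01_isSharpPHardFun`,
`PermanentCodeTranscoder.lean`) is the machine: `w ↦ bWord (decCNF w)` in `FP` and the arithmetic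
post-processing in `FP` (sequel files). Independent of the parallel closed form
`Valiant3CNFMatrix.lean` (`Valiant3CNF.M3`, Valiant's own junctions, entries `{-1,0,1,2,3}`,
factor `16^{3m}`): the two-site matrix keeps entries in `{-1,0,1}`, which is what the one-slot
`0/1` lift used here handles.

## References

* L. G. Valiant, *The complexity of computing the permanent*, Theoret. Comput. Sci. 8 (1979)
  189–201, Thm. 1, Lemma 3.1, Lemma 3.3, §4.
* C. H. Papadimitriou, *Computational Complexity*, Addison-Wesley 1994, proof of Thm. 18.3.
-/

noncomputable section
noncomputable section

namespace Literature.Computability.QuantumComplexity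

open Literature.Computability.Complexity Literature.Computability.AlgebraicComplexity
  Literature.Computability.AlgebraicComplexity.ThreeCNFPer Literature.LinearAlgebra.Matrix Matrix Finset

namespace PerRed

variable (φ : CNF ℕ)

/-! ### Sizes and layouts -/

/-- `|BaseIdx φ| = 7m + 12m`. [folklore] -/
abbrev nB : ℕ := 7 * φ.length + φ.length * 3 * 4

/-- The size `43m` of the two-site matrix. [folklore] -/
abbrev nG : ℕ := nB φ + (φ.length * 3 + φ.length * 3) * 4

/-- The exponent `q = 9m` of the modulus `2^q + 1` (`per ≤ 2^{9m}`). [folklore] -/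
abbrev qMod : ℕ := φ.length * 9

/-- The size `n = 43m + (43m)² (9m + 1)` of the `0/1` matrix. [folklore] -/
abbrev nTot : ℕ := nG φ + nG φ * nG φ * (qMod φ + 1)

/-- The layout of `BaseIdx φ`: first the `7m` nodes of the clause block, then the equality
blocks, block `p` slot `g` at `7m + 4p + g`. [folklore] -/
def eBase : Fin (nB φ) ≃ BaseIdx φ :=
  finSumFinEquiv.symm.trans (Equiv.sumCongr (Equiv.refl _) finProdFinEquiv.symm)

/-- The layout of the two-site matrix: `BaseIdx φ` first, then the cores, variable `k` core
index `g` at `19m + 4k + g`. [folklore] -/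
def eG : Fin (nG φ) ≃ BaseIdx φ ⊕ Fin (φ.length * 3 + φ.length * 3) × Fin 4 :=
  finSumFinEquiv.symm.trans (Equiv.sumCongr (eBase φ) finProdFinEquiv.symm)

/-- **The two-site matrix on `Fin (43m)`.** [cite: Valiant1979, Lemma 3.1] -/
def gMatrix : Matrix (Fin (nG φ)) (Fin (nG φ)) ℤ :=
  (twoSiteMatrix φ).submatrix (eG φ) (eG φ)

/-- The layout of the `0/1` lift: the `43m` old indices first, then slot `s` node `j` at
`43m + s (q+1) + j`. [folklore] -/
def eTot : Fin (nTot φ) ≃ Fin (nG φ) ⊕ Fin (nG φ * nG φ) × Fin (qMod φ + 1) :=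
  finSumFinEquiv.symm.trans (Equiv.sumCongr (Equiv.refl _) finProdFinEquiv.symm)

/-- **The `0/1` matrix of the 3CNF on `Fin n`**: the `0/1` lift modulo `2^q + 1` of the two-site
matrix. [cite: Valiant1979, Thm. 1] -/
def bMatrix : Matrix (Fin (nTot φ)) (Fin (nTot φ)) ℤ :=
  (zeroOneLift (gMatrix φ) (qMod φ)).submatrix (eTot φ) (eTot φ)

/-! ### Permanents -/

/-- The entries of `gMatrix` lie in `{-1, 0, 1}`. [cite: Valiant1979, Lemma 3.1] -/
theorem gMatrix_apply_mem (x y : Fin (nG φ)) :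
    gMatrix φ x y = -1 ∨ gMatrix φ x y = 0 ∨ gMatrix φ x y = 1 :=
  twoSiteMatrix_apply_mem φ _ _

/-- `per (gMatrix φ) = 2^{6m} · #SAT(φ)`. [cite: Valiant1979, Lemma 3.1] -/
theorem permanent_gMatrix (hφ : CNF.IsWidthEq 3 φ) :
    (gMatrix φ).permanent = 2 ^ (φ.length * 3 + φ.length * 3) * (φ.numSat : ℤ) := by
  rw [gMatrix, permanent_submatrix_equiv, permanent_twoSiteMatrix φ hφ]

/-- The `0/1` matrix is a `0/1` matrix. [cite: Valiant1979, Thm. 1] -/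
theorem bMatrix_apply_eq_zero_or_one (x y : Fin (nTot φ)) : bMatrix φ x y = 0 ∨ bMatrix φ x y = 1 :=
  zeroOneLift_apply_eq_zero_or_one _ _ _ _

/-- **Recovering `#SAT` from the `0/1` permanent**:
`(per (bMatrix φ)).toNat % (2^{9m} + 1) = 2^{6m} · #SAT(φ)`. [cite: Valiant1979, Thm. 1] -/
theorem toNat_permanent_bMatrix_mod (hφ : CNF.IsWidthEq 3 φ) :
    (bMatrix φ).permanent.toNat % (2 ^ qMod φ + 1) = 2 ^ (φ.length * 6) * φ.numSat := by
  have hb := permanent_twoSiteMatrix_bounds φ hφ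
  rw [show (twoSiteMatrix φ).permanent = (gMatrix φ).permanent by
    rw [gMatrix, permanent_submatrix_equiv]] at hb
  rw [bMatrix, permanent_submatrix_equiv,
    toNat_permanent_zeroOneLift_mod (gMatrix φ) (qMod φ) (gMatrix_apply_mem φ) hb.1 hb.2,
    permanent_gMatrix φ hφ]
  have : (2 : ℤ) ^ (φ.length * 3 + φ.length * 3) * (φ.numSat : ℤ) = ((2 ^ (φ.length * 6) * φ.numSat : ℕ) : ℤ) := by
    push_cast; ring
  rw [this, Int.toNat_natCast]

/-- **`#SAT(φ) = ((per (bMatrix φ)).toNat % (2^{9m} + 1)) / 2^{6m}`** for a 3CNF `φ` — the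
arithmetic of the oracle machine. [cite: Valiant1979, Thm. 1] -/
theorem numSat_eq (hφ : CNF.IsWidthEq 3 φ) :
    φ.numSat = (bMatrix φ).permanent.toNat % (2 ^ qMod φ + 1) / 2 ^ (φ.length * 6) := by
  rw [toNat_permanent_bMatrix_mod φ hφ, Nat.mul_div_cancel_left _ (Nat.two_pow_pos _)]

/-! ### The entries of the two-site matrix, `ℕ`-indexed -/

/-- The constant equality block `E(0,0,0) = (0,-1,-1,1; 0,0,-1,1; 0,0,0,1; 1,1,1,0)`, `ℕ`-indexed. [folklore] -/
def e3c (g g' : ℕ) : ℤ :=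
  if g = 3 then (if g' = 3 then 0 else 1)
  else if g' = 3 then 1
  else if g' ≤ g then 0 else -1

/-- `e3 0 0 0 = e3c`. [folklore] -/
theorem e3_zero_apply (g g' : Fin 4) : e3 (0 : ℤ) 0 0 g g' = e3c g.val g'.val := by
  fin_cases g <;> fin_cases g' <;> rfl

/-- The two-site core `(1,0,1,0; 0,1,0,-1; 1,1,-1,-1; -1,-1,-1,-1)`, `ℕ`-indexed. [folklore] -/
def coreC (g g' : ℕ) : ℤ :=
  if g = 0 then (if g' = 0 ∨ g' = 2 then 1 else 0)
  else if g = 1 then (if g' = 1 then 1 else if g' = 3 then -1 else 0)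
  else if g = 2 then (if g' ≤ 1 then 1 else -1)
  else -1

/-- `boolSumCore = coreC`. [folklore] -/
theorem boolSumCore_apply (g g' : Fin 4) : (boolSumCore g g' : ℤ) = coreC g.val g'.val := by
  fin_cases g <;> fin_cases g' <;> rfl

/-- **The base matrix, `ℕ`-indexed** (`BaseIdx` numbered by `eBase`: clause-block node `r ↦ r`,
equality block `p` slot `g ↦ 7m + 4p + g`): `hConst` on the clause block, `E(0,0,0)` on the
diagonal equality blocks, `0` elsewhere. [cite: Valiant1979, Lemma 3.1] -/
def baseEntry (x y : ℕ) : ℤ :=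
  if x < 7 * φ.length then (if y < 7 * φ.length then hConst φ x y else 0)
  else if y < 7 * φ.length then 0
  else if (x - 7 * φ.length) / 4 = (y - 7 * φ.length) / 4 then
    e3c ((x - 7 * φ.length) % 4) ((y - 7 * φ.length) % 4) else 0

/-- The number (in the `eBase` numbering) of the first site of variable `k`: `sPos k` for the
clause variable `Y_k` (`k < 3m`), slot `2` of block `p` for the chain variable `U_p`, `p = k - 3m`. [cite: Valiant1979, Lemma 3.1] -/
def site1 (k : ℕ) : ℕ :=
  if k < φ.length * 3 then sPos k else 7 * φ.length + 4 * (k - φ.length * 3) + 2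

/-- The number of the second site of variable `k`: slot `1` of block `k` for `Y_k`, slot `0` of
the block of the next occurrence for `U_p`. [cite: Valiant1979, Lemma 3.1] -/
def site2 (k : ℕ) : ℕ :=
  if k < φ.length * 3 then 7 * φ.length + 4 * k + 1
  else 7 * φ.length + 4 * nextPos (φ.length * 3) (varAt φ) (k - φ.length * 3)

/-- **The ports, `ℕ`-indexed**: the entry between the base index `x` and the core index `(k, g)`
(in either order): `1` if `g = 0` and `x` is the first site of variable `k`, or `g = 1` and `x` is
the second site; `0` otherwise. [cite: Valiant1979, Lemma 3.1] -/
def portEntry (x k g : ℕ) : ℤ :=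
  if g = 0 ∧ x = site1 φ k then 1 else if g = 1 ∧ x = site2 φ k then 1 else 0

/-- **The two-site matrix, `ℕ`-indexed** (numbering `eG`: base indices first, then the core of
variable `k`, index `g`, at `19m + 4k + g`). [cite: Valiant1979, Lemma 3.1] -/
def gEntry (x y : ℕ) : ℤ :=
  if x < nB φ then
    (if y < nB φ then baseEntry φ x y else portEntry φ x ((y - nB φ) / 4) ((y - nB φ) % 4))
  else if y < nB φ then portEntry φ y ((x - nB φ) / 4) ((x - nB φ) % 4)
  else if (x - nB φ) / 4 = (y - nB φ) / 4 then coreC ((x - nB φ) % 4) ((y - nB φ) % 4) else 0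

section Layout

/-- Index bound: equality blocks. [folklore] -/
theorem div_four_lt_of_lt_nB {x : ℕ} (hx : x < nB φ) (h : 7 * φ.length ≤ x) :
    (x - 7 * φ.length) / 4 < φ.length * 3 := by unfold nB at hx; omega

/-- Index bound: cores. [folklore] -/
theorem div_four_lt_of_lt_nG {x : ℕ} (hx : x < nG φ) (h : nB φ ≤ x) :
    (x - nB φ) / 4 < φ.length * 3 + φ.length * 3 := by unfold nG at hx; omega

/-- `eBase` on the clause block. [folklore] -/
theorem eBase_apply_lt (x : Fin (nB φ)) (h : x.val < 7 * φ.length) :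
    eBase φ x = Sum.inl ⟨x.val, h⟩ := by
  have hx : Fin.castAdd _ ⟨x.val, h⟩ = x := Fin.ext rfl
  conv_lhs => rw [← hx]
  simp only [eBase, Equiv.trans_apply, finSumFinEquiv_symm_apply_castAdd, Equiv.sumCongr_apply, Sum.map_inl,
    Equiv.refl_apply]

/-- `eBase` on the equality blocks. [folklore] -/
theorem eBase_apply_ge (x : Fin (nB φ)) (h : 7 * φ.length ≤ x.val) :
    eBase φ x = Sum.inr (⟨(x.val - 7 * φ.length) / 4, div_four_lt_of_lt_nB φ x.isLt h⟩,
      ⟨(x.val - 7 * φ.length) % 4, Nat.mod_lt _ (by norm_num)⟩) := by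
  have hlt : x.val - 7 * φ.length < φ.length * 3 * 4 := by have := x.isLt; unfold nB at this; omega
  have hx : Fin.natAdd _ ⟨x.val - 7 * φ.length, hlt⟩ = x := Fin.ext (by simp; omega)
  conv_lhs => rw [← hx]
  simp only [eBase, Equiv.trans_apply, finSumFinEquiv_symm_apply_natAdd, Equiv.sumCongr_apply, Sum.map_inr,
    finProdFinEquiv_symm_apply, Sum.inr.injEq, Prod.mk.injEq, Fin.ext_iff, Fin.coe_divNat, Fin.coe_modNat,
    and_self]

/-- `eG` on the base indices. [folklore] -/
theorem eG_apply_lt (x : Fin (nG φ)) (h : x.val < nB φ) : eG φ x = Sum.inl (eBase φ ⟨x.val, h⟩) := by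
  have hx : Fin.castAdd _ ⟨x.val, h⟩ = x := Fin.ext rfl
  conv_lhs => rw [← hx]
  simp only [eG, Equiv.trans_apply, finSumFinEquiv_symm_apply_castAdd, Equiv.sumCongr_apply, Sum.map_inl]

/-- `eG` on the cores. [folklore] -/
theorem eG_apply_ge (x : Fin (nG φ)) (h : nB φ ≤ x.val) :
    eG φ x = Sum.inr (⟨(x.val - nB φ) / 4, div_four_lt_of_lt_nG φ x.isLt h⟩,
      ⟨(x.val - nB φ) % 4, Nat.mod_lt _ (by norm_num)⟩) := by
  have hlt : x.val - nB φ < (φ.length * 3 + φ.length * 3) * 4 := by have := x.isLt; unfold nG at this; omega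
  have hx : Fin.natAdd _ ⟨x.val - nB φ, hlt⟩ = x := Fin.ext (by simp; omega)
  conv_lhs => rw [← hx]
  simp only [eG, Equiv.trans_apply, finSumFinEquiv_symm_apply_natAdd, Equiv.sumCongr_apply, Sum.map_inr,
    finProdFinEquiv_symm_apply, Sum.inr.injEq, Prod.mk.injEq, Fin.ext_iff, Fin.coe_divNat, Fin.coe_modNat,
    and_self]

/-- The `eBase`-number of a base index. [folklore] -/
theorem eBase_symm_inl (r : Fin (7 * φ.length)) : ((eBase φ).symm (Sum.inl r)).val = r.val := by
  have h : (eBase φ).symm (Sum.inl r) = ⟨r.val, by have := r.isLt; unfold nB; omega⟩ := by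
    rw [Equiv.symm_apply_eq, eBase_apply_lt]
  rw [h]

/-- The `eBase`-number of an equality-block index. [folklore] -/
theorem eBase_symm_inr (p : Fin (φ.length * 3)) (g : Fin 4) :
    ((eBase φ).symm (Sum.inr (p, g))).val = 7 * φ.length + 4 * p.val + g.val := by
  have hlt : 7 * φ.length + 4 * p.val + g.val < nB φ := by have := p.isLt; have := g.isLt; unfold nB; omega
  have h : (eBase φ).symm (Sum.inr (p, g)) = ⟨7 * φ.length + 4 * p.val + g.val, hlt⟩ := by
    rw [Equiv.symm_apply_eq, eBase_apply_ge φ _ (by simp only; omega)]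
    have hg := g.isLt
    congr 2
    · apply Fin.ext; simp; omega
    · apply Fin.ext; simp; omega
  rw [h]

/-- The first site of variable `k` has `eBase`-number `site1 k`. [cite: Valiant1979, Lemma 3.1] -/
theorem eBase_symm_u1 (k : Fin (φ.length * 3 + φ.length * 3)) :
    ((eBase φ).symm (sites φ k).u₁).val = site1 φ k.val ∧ (sites φ k).v₁ = (sites φ k).u₁ := by
  unfold sites site1
  rcases hk : finSumFinEquiv.symm k with p | p
  · have hkp : k.val = p.val := by
      have := congrArg (fun s => (finSumFinEquiv s : Fin _).val) hk
      simpa using this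
    simp only [Sum.elim_inl, siteY, hkp, p.isLt, if_true, and_true]
    exact eBase_symm_inl φ _
  · have hkp : k.val = p.val + φ.length * 3 := by
      have := congrArg (fun s => (finSumFinEquiv s : Fin _).val) hk
      simpa using this
    simp only [Sum.elim_inr, siteU, hkp, and_true]
    rw [if_neg (by omega), eBase_symm_inr]
    simp

/-- The second site of variable `k` has `eBase`-number `site2 k`. [cite: Valiant1979, Lemma 3.1] -/
theorem eBase_symm_u2 (k : Fin (φ.length * 3 + φ.length * 3)) :
    ((eBase φ).symm (sites φ k).u₂).val = site2 φ k.val ∧ (sites φ k).v₂ = (sites φ k).u₂ := by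
  unfold sites site2
  rcases hk : finSumFinEquiv.symm k with p | p
  · have hkp : k.val = p.val := by
      have := congrArg (fun s => (finSumFinEquiv s : Fin _).val) hk
      simpa using this
    simp only [Sum.elim_inl, siteY, hkp, p.isLt, if_true, and_true]
    rw [eBase_symm_inr]
    simp
  · have hkp : k.val = p.val + φ.length * 3 := by
      have := congrArg (fun s => (finSumFinEquiv s : Fin _).val) hk
      simpa using this
    simp only [Sum.elim_inr, siteU, hkp, and_true]
    rw [if_neg (by omega), eBase_symm_inr]
    simp [nextFin]

end Layout

/-- The ports of the two-site matrix are `portEntry`. [cite: Valiant1979, Lemma 3.1] -/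
theorem glueAll_port (x : Fin (nB φ)) (k : Fin (φ.length * 3 + φ.length * 3)) (g : Fin 4) :
    glueAll (baseMatrix φ) (sites φ) (Sum.inl (eBase φ x)) (Sum.inr (k, g)) = portEntry φ x.val k.val g.val ∧
      glueAll (baseMatrix φ) (sites φ) (Sum.inr (k, g)) (Sum.inl (eBase φ x)) = portEntry φ x.val k.val g.val := by
  obtain ⟨h1, hv1⟩ := eBase_symm_u1 φ k
  obtain ⟨h2, hv2⟩ := eBase_symm_u2 φ k
  have e1 : eBase φ x = (sites φ k).u₁ ↔ x.val = site1 φ k.val := by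
    rw [← h1, ← Fin.ext_iff]
    exact (Equiv.eq_symm_apply (eBase φ)).symm
  have e2 : eBase φ x = (sites φ k).u₂ ↔ x.val = site2 φ k.val := by
    rw [← h2, ← Fin.ext_iff]
    exact (Equiv.eq_symm_apply (eBase φ)).symm
  have hg0 : g = 0 ↔ g.val = 0 := Fin.ext_iff
  have hg1 : g = 1 ↔ g.val = 1 := Fin.ext_iff
  have heps := sites_eps φ k
  rw [glueAll_inl_inr, glueAll_inr_inl, hv1, hv2, heps.1, heps.2]
  unfold portEntry
  simp only [hg0, hg1, e1, e2, and_self]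

/-- **`gMatrix` is `gEntry`.** [cite: Valiant1979, Lemma 3.1] -/
theorem gMatrix_apply (x y : Fin (nG φ)) : gMatrix φ x y = gEntry φ x.val y.val := by
  unfold gMatrix gEntry twoSiteMatrix
  rw [submatrix_apply]
  by_cases hx : x.val < nB φ
  · rw [eG_apply_lt φ x hx, if_pos hx]
    by_cases hy : y.val < nB φ
    · rw [eG_apply_lt φ y hy, if_pos hy, glueAll_inl_inl]
      -- the base matrix
      unfold baseMatrix baseEntry
      by_cases hx7 : x.val < 7 * φ.length
      · rw [eBase_apply_lt φ _ hx7, if_pos hx7]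
        by_cases hy7 : y.val < 7 * φ.length
        · rw [eBase_apply_lt φ _ hy7, if_pos hy7, blockSum_inl_inl, h0_apply]
        · rw [eBase_apply_ge φ _ (by simp only; omega), if_neg hy7, blockSum_inl_inr]
      · rw [eBase_apply_ge φ _ (by simp only; omega), if_neg hx7]
        by_cases hy7 : y.val < 7 * φ.length
        · rw [eBase_apply_lt φ _ hy7, if_pos hy7, blockSum_inr_inl]
        · rw [eBase_apply_ge φ _ (by simp only; omega), if_neg hy7, blockSum_inr_inr]
          simp only [Fin.mk.injEq, e3_zero_apply]
    · rw [eG_apply_ge φ y (not_lt.1 hy), if_neg hy, (glueAll_port φ _ _ _).1]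
  · rw [eG_apply_ge φ x (not_lt.1 hx), if_neg hx]
    by_cases hy : y.val < nB φ
    · rw [eG_apply_lt φ y hy, if_pos hy, (glueAll_port φ _ _ _).2]
    · rw [eG_apply_ge φ y (not_lt.1 hy), if_neg hy, glueAll_inr_inr]
      simp only [Fin.mk.injEq, boolSumCore_apply]

/-! ### The entries of the `0/1` matrix, `ℕ`-indexed -/

/-- The number of active tournament nodes of the slot `(r, c)`: `liftAct q (gEntry r c) ∈ {0, 1, q+1}`. [cite: Valiant1979, §4] -/
def actOf (r c : ℕ) : ℕ := liftAct (qMod φ) (gEntry φ r c)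

/-- **The `0/1` matrix, `ℕ`-indexed** (numbering `eTot`: old index `x ↦ x`, slot `s = r·43m + c`
node `j ↦ 43m + s (q+1) + j`): the entries of `Matrix.multiSlot 0 (q+1)` (`slotMatrix_apply`). [cite: Valiant1979, §4] -/
def bEntry (x y : ℕ) : Bool :=
  if x < nG φ then
    (if y < nG φ then false
     else decide (x = ((y - nG φ) / (qMod φ + 1)) / nG φ ∧ (y - nG φ) % (qMod φ + 1) = 0 ∧
        0 < actOf φ (((y - nG φ) / (qMod φ + 1)) / nG φ) (((y - nG φ) / (qMod φ + 1)) % nG φ)))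
  else if y < nG φ then
    decide (y = ((x - nG φ) / (qMod φ + 1)) % nG φ ∧
      (x - nG φ) % (qMod φ + 1) < actOf φ (((x - nG φ) / (qMod φ + 1)) / nG φ) (((x - nG φ) / (qMod φ + 1)) % nG φ))
  else decide ((x - nG φ) / (qMod φ + 1) = (y - nG φ) / (qMod φ + 1) ∧
    ((x - nG φ) % (qMod φ + 1) = (y - nG φ) % (qMod φ + 1) ∨
      ((x - nG φ) % (qMod φ + 1) < (y - nG φ) % (qMod φ + 1) ∧
        (y - nG φ) % (qMod φ + 1) < actOf φ (((x - nG φ) / (qMod φ + 1)) / nG φ) (((x - nG φ) / (qMod φ + 1)) % nG φ))))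

section LayoutTot

/-- Index bound: slots. [folklore] -/
theorem slot_lt {x : ℕ} (hx : x < nTot φ) (h : nG φ ≤ x) : (x - nG φ) / (qMod φ + 1) < nG φ * nG φ := by
  unfold nTot at hx
  exact Nat.div_lt_of_lt_mul (by rw [Nat.mul_comm]; omega)

/-- `eTot` on the old indices. [folklore] -/
theorem eTot_apply_lt (x : Fin (nTot φ)) (h : x.val < nG φ) : eTot φ x = Sum.inl ⟨x.val, h⟩ := by
  have hx : Fin.castAdd _ ⟨x.val, h⟩ = x := Fin.ext rfl
  conv_lhs => rw [← hx]
  simp only [eTot, Equiv.trans_apply, finSumFinEquiv_symm_apply_castAdd, Equiv.sumCongr_apply, Sum.map_inl,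
    Equiv.refl_apply]

/-- `eTot` on the gadget nodes. [folklore] -/
theorem eTot_apply_ge (x : Fin (nTot φ)) (h : nG φ ≤ x.val) :
    eTot φ x = Sum.inr (⟨(x.val - nG φ) / (qMod φ + 1), slot_lt φ x.isLt h⟩,
      ⟨(x.val - nG φ) % (qMod φ + 1), Nat.mod_lt _ (Nat.succ_pos _)⟩) := by
  have hlt : x.val - nG φ < nG φ * nG φ * (qMod φ + 1) := by have := x.isLt; unfold nTot at this; omega
  have hx : Fin.natAdd _ ⟨x.val - nG φ, hlt⟩ = x := Fin.ext (by simp; omega)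
  conv_lhs => rw [← hx]
  simp only [eTot, Equiv.trans_apply, finSumFinEquiv_symm_apply_natAdd, Equiv.sumCongr_apply, Sum.map_inr,
    finProdFinEquiv_symm_apply, Sum.inr.injEq, Prod.mk.injEq, Fin.ext_iff, Fin.coe_divNat, Fin.coe_modNat,
    and_self]

end LayoutTot

/-- The slot data of the lift. [cite: Valiant1979, §4] -/
theorem entrySlots_liftAct (s : Fin (nG φ * nG φ)) :
    (entrySlots (fun r c => liftAct (qMod φ) (gMatrix φ r c)) s).u.val = s.val / nG φ ∧
      (entrySlots (fun r c => liftAct (qMod φ) (gMatrix φ r c)) s).v.val = s.val % nG φ ∧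
      (entrySlots (fun r c => liftAct (qMod φ) (gMatrix φ r c)) s).act =
        actOf φ (s.val / nG φ) (s.val % nG φ) := by
  simp only [entrySlots, finProdFinEquiv_symm_apply, Fin.coe_divNat, Fin.coe_modNat, actOf, gMatrix_apply,
    and_self]

/-- **`bMatrix` is `bEntry`.** [cite: Valiant1979, Thm. 1] -/
theorem bMatrix_apply (x y : Fin (nTot φ)) : bMatrix φ x y = if bEntry φ x.val y.val then 1 else 0 := by
  unfold bMatrix zeroOneLift bEntry
  rw [submatrix_apply, slotMatrix_apply]
  by_cases hx : x.val < nG φ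
  · rw [eTot_apply_lt φ x hx, if_pos hx]
    by_cases hy : y.val < nG φ
    · rw [eTot_apply_lt φ y hy, if_pos hy]
      rfl
    · rw [eTot_apply_ge φ y (not_lt.1 hy), if_neg hy]
      obtain ⟨hu, -, hact⟩ := entrySlots_liftAct φ ⟨(y.val - nG φ) / (qMod φ + 1), slot_lt φ y.isLt (not_lt.1 hy)⟩
      dsimp only
      simp only [Fin.ext_iff, hu, hact, decide_eq_true_eq]
  · rw [eTot_apply_ge φ x (not_lt.1 hx), if_neg hx]
    obtain ⟨-, hv, hact⟩ := entrySlots_liftAct φ ⟨(x.val - nG φ) / (qMod φ + 1), slot_lt φ x.isLt (not_lt.1 hx)⟩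
    by_cases hy : y.val < nG φ
    · rw [eTot_apply_lt φ y hy, if_pos hy]
      dsimp only
      simp only [Fin.ext_iff, hv, hact, decide_eq_true_eq]
    · rw [eTot_apply_ge φ y (not_lt.1 hy), if_neg hy]
      dsimp only
      simp only [Fin.ext_iff, Fin.lt_def, hact, decide_eq_true_eq]
      by_cases h1 : (x.val - nG φ) / (qMod φ + 1) = (y.val - nG φ) / (qMod φ + 1)
      · simp only [h1, true_and, if_true]
        by_cases h2 : (x.val - nG φ) % (qMod φ + 1) = (y.val - nG φ) % (qMod φ + 1)
        · simp [h2]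
        · simp only [h2, if_false, false_or]
      · simp [h1]

/-! ### The word of the `0/1` matrix -/

/-- **The row-major word of the `0/1` matrix** of the 3CNF (`n²` letters). [cite: Valiant1979, Thm. 1] -/
def bWord : List Bool := List.ofFn fun t : Fin (nTot φ * nTot φ) => bEntry φ (t.val / nTot φ) (t.val % nTot φ)

/-- The word has square length `n²`. [folklore] -/
@[simp] theorem length_bWord : (bWord φ).length = nTot φ * nTot φ := by simp [bWord]

/-- The letters of the word are the entries. [folklore] -/
theorem wordBits_bWord (i j : Fin (nTot φ)) : wordBits (bWord φ) (nTot φ) (i, j) = bEntry φ i.val j.val := by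
  unfold wordBits bWord
  have hlt : i.val * nTot φ + j.val < nTot φ * nTot φ := by
    have hi := i.isLt; have hj := j.isLt
    calc i.val * nTot φ + j.val < i.val * nTot φ + nTot φ := by omega
      _ = (i.val + 1) * nTot φ := by ring
      _ ≤ nTot φ * nTot φ := by rw [Nat.mul_comm]; exact Nat.mul_le_mul_left _ hi
  rw [List.getD_eq_getElem _ _ (by simpa using hlt), List.getElem_ofFn]
  have hn : 0 < nTot φ := by have := i.isLt; omega
  show bEntry φ ((i.val * nTot φ + j.val) / nTot φ) ((i.val * nTot φ + j.val) % nTot φ) = _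
  congr 1
  · rw [Nat.mul_comm, Nat.mul_add_div hn, Nat.div_eq_of_lt j.isLt, add_zero]
  · rw [Nat.mul_comm, Nat.mul_add_mod, Nat.mod_eq_of_lt j.isLt]

/-- **The `0/1` permanent function on the word is `per (bMatrix φ)`.** [cite: Valiant1979, Thm. 1] -/
theorem per01PlainFn_bWord : per01PlainFn (bWord φ) = (bMatrix φ).permanent.toNat := by
  rw [per01PlainFn_of_sq (length_bWord φ)]
  have hB : bMatrix φ = Matrix.of fun i j : Fin (nTot φ) => if wordBits (bWord φ) (nTot φ) (i, j) then (1 : ℤ) else 0 := by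
    ext i j
    rw [Matrix.of_apply, wordBits_bWord, bMatrix_apply]
  rw [hB, permanent_of_bool, Int.toNat_natCast]

/-- **Valiant's reduction on one formula**: for a 3CNF `φ` with `m` clauses,
`#SAT(φ) = (PER(bWord φ) % (2^{9m} + 1)) / 2^{6m}` where `PER = per01PlainFn` is the row-major
`0/1` permanent function. [cite: Valiant1979, Thm. 1] -/
theorem numSat_eq_per01PlainFn (hφ : CNF.IsWidthEq 3 φ) :
    φ.numSat = per01PlainFn (bWord φ) % (2 ^ qMod φ + 1) / 2 ^ (φ.length * 6) := by
  rw [per01PlainFn_bWord, ← numSat_eq φ hφ]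

end PerRed

end Literature.Computability.QuantumComplexity
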